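import Mathlib
import HarnessLib
import Literature.Analysis.FluidPDE.ClassicalSolution
import Literature.Analysis.FluidPDE.ClassicalSolutionRescale
import Literature.Analysis.FluidPDE.ClassicalSolutionGlue
import Literature.Analysis.FluidPDE.SelfSimilar
import Literature.Analysis.FluidPDE.AxisymmetricEuler
import Literature.Analysis.FluidPDE.NSLerayStrongLocalExistence
import Literature.Analysis.FluidPDE.NSBoundedMildSmoothing
import Literature.Analysis.FluidPDE.KNSSOseenMildDecayOfLemma31
import Literature.Analysis.FluidPDE.KNSSWeakDriftMildProofs
import Literature.Analysis.FluidPDE.ChaeWolfRemovingDSSBounds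
import Literature.Analysis.FluidPDE.ChaeWolfRemovingDSSLimit
import Literature.Analysis.FluidPDE.KNSSBlowupLimit
import Summits.NavierStokesRegularity.NavierStokesRegularity.Theorems.TypeICertificateLadderTargetRssCompactnessPressureCover
import Summits.NavierStokesRegularity.NavierStokesRegularity.Theorems.LocalSineTubeDoorProfileAlignedWindowRigidityAncient
import Summits.NavierStokesRegularity.NavierStokesRegularity.Theorems.ZoomReturnDoorDefs
import Summits.NavierStokesRegularity.NavierStokesRegularity.Theorems.ZoomReturnDoorDssExtension
import Summits.NavierStokesRegularity.NavierStokesRegularity.Theorems.ZoomReturnDoorLimit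

/-!
# ZoomReturnDoorGlue — S25 «ZoomReturnDoor», kit part 7/7 §2: proved glue

B4 `extension_classical` (the DSS extension of part 5 is classical: `nsRescale_holds` + `congr_velocity` +
`rssCompact_exists_pressure_of_cover`), zoom covariance of the class / decay / profile defect / small echo / DSS
(`isClassical_nsRescale`, `hasTypeIDecay_nsRescale`, `profileDefect_nsRescale`, `hasSmallEchoOn_nsRescale`,
`isDiscretelySelfSimilar_nsRescale`), B0 `normalise` (ε-regularity `ChaeWolf.exists_eps_typeI_small_eq_zero` + zoom),
`tendsto_of_locUnif`, `bounds_of_decay`.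

Door family of LADDER-NS N0; THEOREMS-ONLY landing (lane ns-door-S23-p1, DIRECTOR-NS #73 (2)) of the nsreg-p1 g20 kit part 7/7
`run/shared/lean/pub/ns-regularity-ideate/ns-regularity-ideate-p1/r24/landing/ZoomReturnDoorSkeleton.lean` (ADDENDUM-24C rev 3,
93b5c61024a69aa0), split into three files ≤ 400 lines; its one stub E2 `stub_classical_limit` is the tree theorem
`ZoomReturnDoorClassicalLimit.classical_limit`. WHAT THIS IS NOT: not NS regularity; no route, no item.
-/

noncomputable section

set_option linter.dupNamespace false

namespace Summit.NavierStokesRegularity.NavierStokesRegularity.Theorems.ZoomReturnDoorGlue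

open MeasureTheory Set Function Filter Topology Metric
open scoped ENNReal NNReal Topology
open Literature.Analysis Literature.Analysis.FluidPDE
open Summit.NavierStokesRegularity.NavierStokesRegularity.Theorems.ZoomReturnDoorDefs
open Summit.NavierStokesRegularity.NavierStokesRegularity.Theorems.ZoomReturnDoorDssExtension
open Summit.NavierStokesRegularity.NavierStokesRegularity.Theorems.ZoomReturnDoorLimit

/-! ## §2 Proved glue: the DSS extension is classical; zoom covariance of the class, of the decay and of the small
echo; normalisation B0 -/

/-- **B4/G4-analytic — THE DSS EXTENSION IS CLASSICAL** (PROVED plumbing): on the open piece `Iio (t₀ c^{−2m})` the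
field `w` is the `m`-fold rescaling `nsRescale (c^m) v` (`dssExtend_eq`, part 5), classical there by
`IsClassicalNSSolutionOn.nsRescale_holds` + `mono` + `congr_velocity`; the pieces cover `Iio 0` and ONE pressure is
produced by the tree's cover lemma `rssCompact_exists_pressure_of_cover`. -/
theorem extension_classical {c t₀ t₁ : ℝ} (hc : 1 < c) (ht₀₁ : t₀ < t₁)
    {v w : ℝ → EuclideanSpace ℝ (Fin 3) → EuclideanSpace ℝ (Fin 3)} {p : ℝ → EuclideanSpace ℝ (Fin 3) → ℝ} (hv : IsClassicalNSSolutionOn (Iio t₁) 1 0 v p)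
    (hw : ∀ (m : ℕ) (t : ℝ), c ^ (2 * m) * t ≤ t₀ → ∀ x, w t x = (c ^ m) • v (c ^ (2 * m) * t) ((c ^ m) • x)) :
    ∃ q : ℝ → EuclideanSpace ℝ (Fin 3) → ℝ, IsClassicalNSSolutionOn (Iio 0) 1 0 w q := by
  have hc0 : 0 < c := by linarith
  have hpm : ∀ m : ℕ, (c ^ m) ^ 2 = c ^ (2 * m) := fun m => by rw [← pow_mul, mul_comm]
  have hpiece : ∀ m : ℕ, IsClassicalNSSolutionOn (Iio (t₀ / c ^ (2 * m))) 1 0 w (nsRescalePressure (c ^ m) p) := by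
    intro m
    have hcm : 0 < c ^ m := pow_pos hc0 m
    have hc2m : 0 < c ^ (2 * m) := pow_pos hc0 _
    have h1 := IsClassicalNSSolutionOn.nsRescale_holds hv hcm
    rw [nsRescaleForce_zero] at h1
    have hsub : Iio (t₀ / c ^ (2 * m)) ⊆ (fun t => (c ^ m) ^ 2 * t) ⁻¹' Iio t₁ := by
      intro t ht
      simp only [mem_preimage, mem_Iio] at ht ⊢
      rw [lt_div_iff₀ hc2m] at ht
      rw [hpm m]
      linarith [mul_comm t (c ^ (2 * m))]
    refine (h1.mono hsub (uniqueDiffOn_Iio _)).congr_velocity fun t ht => ?_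
    funext x
    have ht' : c ^ (2 * m) * t ≤ t₀ := by
      simp only [mem_Iio] at ht
      rw [lt_div_iff₀ hc2m] at ht
      linarith [mul_comm t (c ^ (2 * m))]
    rw [hw m t ht' x, nsRescale_apply, hpm m]
  have hcov : ∀ t ∈ Iio (0 : ℝ), ∃ m : ℕ, t ∈ Iio (t₀ / c ^ (2 * m)) := by
    intro t ht
    simp only [mem_Iio] at ht ⊢
    have hc2 : 1 < c ^ 2 := by nlinarith
    obtain ⟨m, hm⟩ := pow_unbounded_of_one_lt (t₀ / t) hc2
    refine ⟨m, ?_⟩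
    have hc2m : 0 < c ^ (2 * m) := pow_pos hc0 _
    rw [← pow_mul] at hm
    rw [lt_div_iff₀ hc2m]
    have := (div_lt_iff_of_neg ht).1 hm
    linarith [mul_comm t (c ^ (2 * m))]
  exact rssCompact_exists_pressure_of_cover 1 0 w (Iio 0) (fun m => Iio (t₀ / c ^ (2 * m)))
    (fun m => nsRescalePressure (c ^ m) p) isOpen_Iio (fun _ => isOpen_Iio) hcov hpiece


/-- The time dilation `t ↦ c² t` (`c > 0`) preserves the half-line `(−∞, 0)`. -/
theorem preimage_sq_mul_Iio_zero {c : ℝ} (hc : 0 < c) : (fun t : ℝ => c ^ 2 * t) ⁻¹' Iio 0 = Iio 0 := by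
  ext t
  simp only [mem_preimage, mem_Iio]
  constructor
  · intro h
    by_contra ht
    push Not at ht
    have : 0 ≤ c ^ 2 * t := mul_nonneg (by positivity) ht
    linarith
  · intro h
    exact mul_neg_of_pos_of_neg (by positivity) h

/-- classical fields on `Iio 0` rescale to classical fields on `Iio 0`. -/
theorem isClassical_nsRescale {u : ℝ → EuclideanSpace ℝ (Fin 3) → EuclideanSpace ℝ (Fin 3)} {p : ℝ → EuclideanSpace ℝ (Fin 3) → ℝ} (h : IsClassicalNSSolutionOn (Iio 0) 1 0 u p)
    {lam : ℝ} (hlam : 0 < lam) :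
    IsClassicalNSSolutionOn (Iio 0) 1 0 (nsRescale lam u) (nsRescalePressure lam p) := by
  have h1 := IsClassicalNSSolutionOn.nsRescale_holds h hlam
  rwa [preimage_sq_mul_Iio_zero hlam, nsRescaleForce_zero] at h1

/-- the Type-I decay constant is zoom invariant. -/
theorem hasTypeIDecay_nsRescale {D : ℝ} {u : ℝ → EuclideanSpace ℝ (Fin 3) → EuclideanSpace ℝ (Fin 3)} (h : HasTypeIDecay D u) {lam : ℝ} (hlam : 0 < lam) :
    HasTypeIDecay D (nsRescale lam u) := by
  intro t ht x
  rw [nsRescale_apply, norm_smul, Real.norm_of_nonneg hlam.le]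
  have hlt : lam ^ 2 * t < 0 := mul_neg_of_pos_of_neg (by positivity) ht
  have hs := h (lam ^ 2 * t) hlt (lam • x)
  have hsq : Real.sqrt (-(lam ^ 2 * t)) = lam * Real.sqrt (-t) := by
    rw [show -(lam ^ 2 * t) = lam ^ 2 * (-t) by ring, Real.sqrt_mul (by positivity), Real.sqrt_sq hlam.le]
  rw [norm_smul, Real.norm_of_nonneg hlam.le, hsq, ← mul_add] at hs
  have hden : 0 < ‖x‖ + Real.sqrt (-t) := by
    have : 0 < Real.sqrt (-t) := Real.sqrt_pos.2 (by linarith)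
    positivity
  calc lam * ‖u (lam ^ 2 * t) (lam • x)‖ ≤ lam * (D / (lam * (‖x‖ + Real.sqrt (-t)))) := by gcongr
    _ = D / (‖x‖ + Real.sqrt (-t)) := by field_simp

/-- the profile defect density is zoom COVARIANT: `profileDefect(nsRescale λ u)(s) = profileDefect(u)(λ² s)`. -/
theorem profileDefect_nsRescale {ν : ℝ} (u : ℝ → EuclideanSpace ℝ (Fin 3) → EuclideanSpace ℝ (Fin 3)) {lam : ℝ} (hlam : 0 < lam) (κ μ : ℝ)
    {s : ℝ} (y : EuclideanSpace ℝ (Fin 3)) :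
    profileDefect ν (nsRescale lam u) κ μ s y = profileDefect ν u κ μ (lam ^ 2 * s) y := by
  have hsq : Real.sqrt (-(lam ^ 2 * s)) = lam * Real.sqrt (-s) := by
    rw [show -(lam ^ 2 * s) = lam ^ 2 * (-s) by ring, Real.sqrt_mul (by positivity), Real.sqrt_sq hlam.le]
  simp only [profileDefect, nsRescale_apply, smul_smul, hsq]
  rw [show √(-s) / √ν * ν * lam = lam * √(-s) / √ν * ν by ring,
    show lam * (√(-s) / √ν) = lam * √(-s) / √ν by ring,
    show μ * (√(-s) / √ν) * ν * lam = μ * (lam * √(-s) / √ν) * ν by ring,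
    show lam * (μ * (√(-s) / √ν)) = μ * (lam * √(-s) / √ν) by ring,
    show lam ^ 2 * (κ * s) = κ * (lam ^ 2 * s) by ring]

/-- the small-echo hypothesis is zoom INVARIANT. -/
theorem hasSmallEchoOn_nsRescale {ν : ℝ} {κ μ ε : ℝ} {U : Set (EuclideanSpace ℝ (Fin 3))} {u : ℝ → EuclideanSpace ℝ (Fin 3) → EuclideanSpace ℝ (Fin 3)}
    (h : HasSmallEchoOn ν κ μ ε U u) {lam : ℝ} (hlam : 0 < lam) : HasSmallEchoOn ν κ μ ε U (nsRescale lam u) := by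
  intro s hs
  have hls : lam ^ 2 * s < 0 := mul_neg_of_pos_of_neg (by positivity) hs
  have := h (lam ^ 2 * s) hls
  calc ∫⁻ y in U, ENNReal.ofReal (profileDefect ν (nsRescale lam u) κ μ s y)
      = ∫⁻ y in U, ENNReal.ofReal (profileDefect ν u κ μ (lam ^ 2 * s) y) := by
        refine lintegral_congr (fun y => ?_)
        rw [profileDefect_nsRescale u hlam κ μ]
    _ ≤ ENNReal.ofReal ε := this

/-- **B0 — NORMALISATION** (proved): uniform witness constants `η, R` (depending on `D` and the witness time `T < 0`
only) such that every NONTRIVIAL classical Type-I(`D`) field on `Iio 0` has a zoom `nsRescale λ u` with a witness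
`‖z‖ ≤ R`, `η ≤ ‖(nsRescale λ u) T z‖` — from the tree's ε-regularity `ChaeWolf.exists_eps_typeI_small_eq_zero`. -/
theorem normalise {D T : ℝ} (hD : 0 < D) (hT : T < 0) :
    ∃ η > 0, ∃ R : ℝ, ∀ (u : ℝ → EuclideanSpace ℝ (Fin 3) → EuclideanSpace ℝ (Fin 3)) (p : ℝ → EuclideanSpace ℝ (Fin 3) → ℝ), IsClassicalNSSolutionOn (Iio 0) 1 0 u p →
      HasTypeIDecay D u → (∃ t < 0, ∃ x, u t x ≠ 0) →
      ∃ lam > 0, ∃ z : EuclideanSpace ℝ (Fin 3), ‖z‖ ≤ R ∧ η ≤ ‖nsRescale lam u T z‖ := by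
  obtain ⟨ε₀, hε₀, hsmall⟩ := ChaeWolf.exists_eps_typeI_small_eq_zero
  have hsT : 0 < Real.sqrt (-T) := Real.sqrt_pos.2 (by linarith)
  refine ⟨ε₀ / Real.sqrt (-T), by positivity, D * Real.sqrt (-T) / ε₀, ?_⟩
  intro u p hcl hdec hnt
  -- contrapositive of ε-regularity: a point where `√(-t) ‖u‖ > ε₀`
  have hpt : ∃ t < 0, ∃ x, ε₀ < Real.sqrt (-t) * ‖u t x‖ := by
    by_contra hno
    push Not at hno
    obtain ⟨t, ht, x, hx⟩ := hnt
    exact hx (hsmall hD.le hcl hdec hno t ht x)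
  obtain ⟨t, ht, x, hx⟩ := hpt
  -- zoom factor with `λ² T = t`
  set lam : ℝ := Real.sqrt (t / T) with hlam_def
  have hratio : 0 < t / T := div_pos_of_neg_of_neg ht hT
  have hlam : 0 < lam := Real.sqrt_pos.2 hratio
  have hlam2 : lam ^ 2 * T = t := by
    rw [hlam_def, Real.sq_sqrt hratio.le]; field_simp [hT.ne]
  have hsqrt : lam * Real.sqrt (-T) = Real.sqrt (-t) := by
    rw [← hlam2, show -(lam ^ 2 * T) = lam ^ 2 * (-T) by ring, Real.sqrt_mul (by positivity),
      Real.sqrt_sq hlam.le]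
  refine ⟨lam, hlam, lam⁻¹ • x, ?_, ?_⟩
  · -- position bound from the decay at the witness point
    have hval : nsRescale lam u T (lam⁻¹ • x) = lam • u t x := by
      rw [nsRescale_apply, hlam2, smul_smul, mul_inv_cancel₀ hlam.ne', one_smul]
    have hdecT := hasTypeIDecay_nsRescale hdec hlam T hT (lam⁻¹ • x)
    rw [hval, norm_smul, Real.norm_of_nonneg hlam.le] at hdecT
    -- `ε₀ < √(-t) ‖u t x‖ = λ √(-T) ‖u t x‖`, so `ε₀ / √(-T) < λ ‖u t x‖ ≤ D / (‖z‖ + √(-T))`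
    have h1 : ε₀ / Real.sqrt (-T) < lam * ‖u t x‖ := by
      rw [div_lt_iff₀ hsT, mul_comm, ← mul_assoc, mul_comm (Real.sqrt (-T)) lam, hsqrt]; exact hx
    have hden : 0 < ‖lam⁻¹ • x‖ + Real.sqrt (-T) := by positivity
    have h2 : ε₀ / Real.sqrt (-T) < D / (‖lam⁻¹ • x‖ + Real.sqrt (-T)) := h1.trans_le hdecT
    rw [div_lt_div_iff₀ hsT hden] at h2
    -- `ε₀ (‖z‖ + √(-T)) < D √(-T)` ⇒ `‖z‖ < D √(-T)/ε₀`
    rw [le_div_iff₀ hε₀]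
    nlinarith [norm_nonneg (lam⁻¹ • x), hsT]
  · have hval : nsRescale lam u T (lam⁻¹ • x) = lam • u t x := by
      rw [nsRescale_apply, hlam2, smul_smul, mul_inv_cancel₀ hlam.ne', one_smul]
    rw [hval, norm_smul, Real.norm_of_nonneg hlam.le, div_le_iff₀ hsT, mul_comm, ← mul_assoc,
      mul_comm (Real.sqrt (-T)) lam, hsqrt]
    exact hx.le

/-- DSS is zoom invariant (the zooms commute). -/
theorem isDiscretelySelfSimilar_nsRescale {c lam : ℝ} {u : ℝ → EuclideanSpace ℝ (Fin 3) → EuclideanSpace ℝ (Fin 3)} (h : IsDiscretelySelfSimilar c u) :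
    IsDiscretelySelfSimilar c (nsRescale lam u) := by
  unfold IsDiscretelySelfSimilar at *
  rw [← nsRescale_mul, mul_comm, nsRescale_mul, h]

/-- locally uniform convergence along `φ` ⇒ continuous convergence along every further subsequence `φ ∘ ψ`. -/
theorem tendsto_of_locUnif {u : ℕ → ℝ → EuclideanSpace ℝ (Fin 3) → EuclideanSpace ℝ (Fin 3)} {v : ℝ → EuclideanSpace ℝ (Fin 3) → EuclideanSpace ℝ (Fin 3)} {φ ψ : ℕ → ℕ} {t₁ : ℝ}
    (hlu : ∀ t < t₁, ∀ (y : EuclideanSpace ℝ (Fin 3)) (ε : ℝ), 0 < ε → ∃ δ > 0, ∃ N : ℕ, ∀ n ≥ N, ∀ (t' : ℝ) (y' : EuclideanSpace ℝ (Fin 3)),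
        |t' - t| < δ → dist y' y < δ → dist (u (φ n) t' y') (v t y) < ε)
    (hψ : StrictMono ψ) :
    ∀ t < t₁, ∀ (y : EuclideanSpace ℝ (Fin 3)) (tn : ℕ → ℝ) (yn : ℕ → EuclideanSpace ℝ (Fin 3)), Tendsto tn atTop (𝓝 t) → Tendsto yn atTop (𝓝 y) →
      Tendsto (fun n => u (φ (ψ n)) (tn n) (yn n)) atTop (𝓝 (v t y)) := by
  intro t ht y tn yn htn hyn
  rw [Metric.tendsto_atTop]
  intro ε hε
  obtain ⟨δ, hδ, N, hN⟩ := hlu t ht y ε hε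
  obtain ⟨M₁, hM₁⟩ := (Metric.tendsto_atTop.1 htn) δ hδ
  obtain ⟨M₂, hM₂⟩ := (Metric.tendsto_atTop.1 hyn) δ hδ
  obtain ⟨M₃, hM₃⟩ := eventually_atTop.1 ((hψ.tendsto_atTop).eventually (eventually_ge_atTop N))
  refine ⟨max M₁ (max M₂ M₃), fun n hn => ?_⟩
  have hn1 : M₁ ≤ n := le_trans (le_max_left _ _) hn
  have hn2 : M₂ ≤ n := le_trans ((le_max_left _ _).trans (le_max_right _ _)) hn
  have hn3 : M₃ ≤ n := le_trans ((le_max_right _ _).trans (le_max_right _ _)) hn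
  have h1 : |tn n - t| < δ := by simpa [Real.dist_eq] using hM₁ n hn1
  exact hN (ψ n) (hM₃ n hn3) (tn n) (yn n) h1 (hM₂ n hn2)

/-- the decay on `t ≤ −1/4` gives the two bounds E3 `analytic_slices_of_decay` wants below `−1/4`. -/
theorem bounds_of_decay {D : ℝ} (hD : 0 < D) {v : ℝ → EuclideanSpace ℝ (Fin 3) → EuclideanSpace ℝ (Fin 3)}
    (hdecv : ∀ t ≤ -(1 / 4 : ℝ), ∀ y, ‖v t y‖ ≤ D / (‖y‖ + Real.sqrt (-t))) :
    (∀ t < -(1 / 4 : ℝ), ∀ y, ‖v t y‖ ≤ 2 * D) ∧ (∀ t < -(1 / 4 : ℝ), ∀ y : EuclideanSpace ℝ (Fin 3), ‖y‖ * ‖v t y‖ ≤ D) := by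
  have hhalf : ∀ t < -(1 / 4 : ℝ), (1 / 2 : ℝ) ≤ Real.sqrt (-t) := by
    intro t ht
    rw [show (1 / 2 : ℝ) = Real.sqrt (1 / 4) by
      rw [show (1 / 4 : ℝ) = (1 / 2) ^ 2 by norm_num, Real.sqrt_sq (by norm_num)]]
    exact Real.sqrt_le_sqrt (by linarith)
  refine ⟨fun t ht y => ?_, fun t ht y => ?_⟩
  · have h1 := hdecv t ht.le y
    have hden : (1 / 2 : ℝ) ≤ ‖y‖ + Real.sqrt (-t) := by linarith [norm_nonneg y, hhalf t ht]
    calc ‖v t y‖ ≤ D / (‖y‖ + Real.sqrt (-t)) := h1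
      _ ≤ D / (1 / 2) := by gcongr
      _ = 2 * D := by ring
  · have h1 := hdecv t ht.le y
    have hs : 0 < Real.sqrt (-t) := Real.sqrt_pos.2 (by linarith)
    have hden : 0 < ‖y‖ + Real.sqrt (-t) := by positivity
    rw [le_div_iff₀ hden] at h1
    nlinarith [norm_nonneg y, norm_nonneg (v t y)]

end Summit.NavierStokesRegularity.NavierStokesRegularity.Theorems.ZoomReturnDoorGlue

end
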